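import Summits.Langlands.Langlands.Theses.SqrtFiveQuarticCovers

/-!
# Birth skeleton (BC3) — crux `BoxBorelFive` (stmt-Langlands-17835), route `SqrtFiveQuarticCovers`

Route `route-Langlands-SqrtFiveQuarticCovers` (Langlands/Langlands); crux decl
`Summit.Langlands.Langlands.Theses.SqrtFiveQuarticCovers.BoxBorelFive` (rank 4):

  for `K` totally real quartic with `√5 ∈ K` and `E / 𝓞 K` (`Δ ≠ 0`) admitting framings of
  `E[3], E[5], E[7]` with mod-3 image in `B(3)` or `C_s⁺(3)`, mod-5 image in `B(5)` and mod-7 image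
  in `B(7)` or `G(e7)`, the curve is modular (geometric CM, or a weight-zero cuspidal `π` of
  `GL₂(𝔸_K)` with `T_w`-eigenvalue `a_w(E)` at cofinitely many `w` — `IsModularEllipticCurve`
  written out, rev 5 of the route).

## The line: Box's own case split by the degree of the `j`-invariant (Box 2022, p. 5)

Such an `E` is a `K`-point `P` of one of the four `b5`-curves `X₀(105) = X(b3,b5,b7)`,
`X(s3,b5,b7)`, `X(b3,b5,e7)`, `X(s3,b5,e7)` (Box 2022 §1.1), and `ℚ(j(P)) ⊆ K` has degree 1, 2
or 4.  Box's printed reduction (arXiv:2103.13975 p. 5, paragraph before Thm. 1.5): "it suffices to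
find the quartic points `P` whose `j`-invariant also has degree 4: if smaller, then `P` is supported
on an elliptic curve that either has `j ∈ {0, 1728}` … or is a quadratic twist `E' ⊗ χ` of a curve
`E'` defined over a field of degree ≤ 2, known to be modular … then `E` is also modular".  The two
halves use DIFFERENT inputs and are registered as two stubs; `j` is rendered as the element
`c₄(E_K)³ / Δ(E_K)` of `K` (Mathlib's `WeierstrassCurve.j` unfolded, no `IsElliptic` instance
needed) and "degree of `j`" as `(minpoly ℚ j).natDegree` (`= [ℚ(j) : ℚ] ∈ {1, 2, 4}`).

* `stub_smallJ` (KNOWN IN PRINT; M/L-sized in-tree): an elliptic curve over a totally real QUARTIC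
  field whose `j`-invariant has degree ≤ 2 over `ℚ` is modular.  No level structure and no `√5`
  hypothesis — they play no role: `j ∈ k := ℚ(j)`, `[k : ℚ] ≤ 2`, `k` totally real; for
  `j ∉ {0, 1728}` `E_K` is a quadratic twist of `(E₀)_K` with `E₀ / k`, `j(E₀) = j`, and `E₀` is
  modular over `k` (BCDT over `ℚ`; Freitas–Le Hung–Siksek 2015 Thm. 1 over real quadratic `k`,
  INCLUDING `ℚ(√5)`, their Lemma (lem:Qsqrt5)); base change along the totally real extension `K / k`
  (quadratic, or quartic with solvable Galois closure: Langlands / Arthur–Clozel + solvable descent)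
  and twist-invariance give modularity of `E / K`; `j ∈ {0, 1728}` is geometric CM (first disjunct).
  Tree facts to consume: `Literature.NumberTheory.Automorphic.FLS2015_theorem1`, the BCDT fact of
  `BCDTModularity.lean`, `SolvableBaseChangeModularity.lean`, `QuadraticCharacterTwist.lean`.
* `stub_quarticJ` (KNOWN IN PRINT = Box 2022 Thm. 1.5 with Thm. 1.4; provable now from the landed
  named fact `Literature.NumberTheory.Automorphic.Box2022_theorem1_5_modular` through
  `IsHilbertModular.of_isAutomorphicOfWeightZero` / `.isModularEllipticCurve`): under the crux
  hypotheses and `2 < (minpoly ℚ j).natDegree` (i.e. `ℚ(j) = K`, "quartic `j`"), `E` is modular —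
  Thm. 1.5: every quartic point with quartic `j` on the four curves is a `ℚ`-curve or has a
  non-totally-real `j` (Table 1; excluded here since `K` is totally real); Thm. 1.4 (Ribet,
  Khare–Wintenberger): `ℚ`-curves are modular.  This is the half where the route's "why it might
  fail" lives (did Box's sieve on the four curves use `√5 ∉ K`? — per the refuter's reading of
  Thm. 1.5, no: it is a statement about ALL quartic points).

Assembly: the glue `BoxBorelFive_of_stubs (hS : <stub_smallJ-sig>) (hQ : <stub_quarticJ-sig>) :
<body of BoxBorelFive>` is a real (short) sorry-free proof — `Nat.lt_or_ge 2 (minpoly ℚ j).natDegree`,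
each branch one stub — and the registered skeleton theorem
`BoxBorelFive_of : BoxBorelFive := BoxBorelFive_of_stubs stub_smallJ stub_quarticJ` concludes the crux
BY NAME (A12 shape, as in the registered ABC/BalancedFamily birth skeleton).  `sorry` occurs ONLY in
the two `stub_*` theorems.

BC3 (planner folder `bc/`, farm 2026-08-17; budget `maxHeartbeats 400000` per probe as prescribed,
plus supplements): every probe FAILS as required, the control `BoxBorelFive → BoxBorelFive` closes by
`exact?` (rc 0).
* `stub_smallJ → BoxBorelFive`: `exact?` "could not close the goal"; `simpa` assumption failed;
  `aesop` "failed to prove the goal after exhaustive search"; `simpa [BoxBorelFive]`,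
  `unfold BoxBorelFive; simpa`, `unfold …; aesop` time out at 400k.  Best manual attempt
  (`intro …; refine hS K hK hd E hE ?_`) leaves the residual `(minpoly ℚ j).natDegree ≤ 2`, on which
  `assumption | exact? | simp | omega | linarith` (full crux context) and
  `exact? | simp_all | aesop | omega` (scalar context) fail with unsolved goals.
* `stub_smallJ → Langlands`: all six of `exact? | simpa | simpa [Langlands] | (unfold Langlands; simpa)
  | aesop | (unfold Langlands; aesop)` fail conclusively (could not close / assumption failed /
  exhaustive search failed).
* `stub_quarticJ → BoxBorelFive`: `exact?` "could not close the goal"; the `simpa`/`aesop` variants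
  time out at 400k on the large hypothesis, so they were re-run as
  `aesop (config := { enableSimp := false, terminal := true })` at 4 000 000 heartbeats, folded and
  unfolded: "failed to prove the goal after exhaustive search" both times; the residual of the best
  manual attempt, `2 < (minpoly ℚ j).natDegree`, fails `assumption | exact? | simp | omega | linarith`
  and `exact? | simp_all | aesop | omega`.
* `stub_quarticJ → Langlands`: `exact?` could not close; `simpa`/`aesop` variants time out at 400k;
  `aesop` (no simp, 4M heartbeats) folded and unfolded: exhaustive search failed (remaining goals
  `Nonempty (ReciprocityData F)` / `GlobalLanglandsCorrespondenceGLn n F 𝓡 hcpt`).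
No stub is cheaply the crux or the summit (no shredding / costume): each stub lacks exactly the other
`j`-degree regime, and neither regime condition is derivable.

Disproof used: none exists for this crux (`ledger crux ls stmt-Langlands-17835`: no workfiles,
2026-08-17).  Negatives index (Langlands): one K3 typing kill, unrelated.
-/

-- `Summit.<Summit>.<Problem>`: for the single-conjunct summit `Langlands` the duplicate is mandated.
set_option linter.dupNamespace false

namespace Summit.Langlands.Langlands.Cruxes.BoxBorelFive.Birth

open scoped BigOperators Topology Manifold Classical MeasureTheory ProbabilityTheory Matrix InnerProductSpace ComplexConjugate ContinuousMap
open Filter Set Function TopologicalSpace MeasureTheory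
open Summit.Langlands.Langlands.Theses.SqrtFiveQuarticCovers

/-! ## The registered stubs -/

/-- **Stub 1 (`j` of degree ≤ 2; KNOWN IN PRINT, M/L-sized in-tree).**  For `K` totally real with
`[K : ℚ] = 4` and `E / 𝓞 K` with `Δ(E) ≠ 0` whose `j`-invariant `j = c₄(E_K)³ / Δ(E_K)` satisfies
`(minpoly ℚ j).natDegree ≤ 2` (i.e. `j` lies in `ℚ` or in a (real) quadratic subfield of `K`),
`E` is modular in the route's written-out sense (geometric CM, or a weight-zero cuspidal `π` of
`GL₂(𝔸_K)` with `√(Nw) · (Satake sum) = a_w(E)` at cofinitely many finite places `w`).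
Why plausibly true: it IS true in print — `E_K` is geometrically CM (`j ∈ {0, 1728}` included) or a
quadratic twist of the base change of a curve `E₀` over `k = ℚ(j)`, `[k : ℚ] ≤ 2`, modular over `k`
by BCDT 2001 (`k = ℚ`) / Freitas–Le Hung–Siksek 2015 Thm. 1 (real quadratic `k`, incl. `ℚ(√5)`);
modularity ascends along the totally real extension `K / k` (cyclic quadratic base change, or
quartic with solvable Galois closure: Arthur–Clozel + solvable descent) and is twist-invariant.
Sources: Box2022 p. 5 (paragraph before Thm. 1.5); FreitasLeHungSiksek2015 Thm. 1;
BCDT2001 Thm. A; Langlands 1980 / ArthurClozel1989 (base change).  Leans on (tree):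
`Literature.NumberTheory.Automorphic.FLS2015_theorem1`, `SolvableBaseChangeModularity`,
`QuadraticCharacterTwist`, `IsHilbertModular.isModularEllipticCurve`. -/
theorem stub_smallJ :
    ∀ (K : Type) [Field K] [NumberField K], NumberField.IsTotallyReal K → Module.finrank ℚ K = 4 → ∀ E : WeierstrassCurve (NumberField.RingOfIntegers K), E.Δ ≠ 0 → (minpoly ℚ ((E.baseChange K).c₄ ^ 3 / (E.baseChange K).Δ)).natDegree ≤ 2 → ((E.baseChange K).HasCM ∨ ∃ (hF : Literature.NumberTheory.Automorphic.isCompact_glFiniteIntegralLevel 2 K) (π : Literature.NumberTheory.Automorphic.CuspidalAutomorphicRepData 2 K hF), π.1.HasWeightZero ∧ ∀ᶠ w : IsDedekindDomain.HeightOneSpectrum (NumberField.RingOfIntegers K) in Filter.cofinite, ∃ α : Multiset ℂ, π.1.HasSatakeParamAt w α ∧ ((Real.sqrt w.residueCard : ℝ) : ℂ) * α.sum = (Literature.NumberTheory.Automorphic.frobTraceAt E w : ℂ)) := by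
  sorry

/-- **Stub 2 (quartic `j` on Box's four `b5`-curves; KNOWN IN PRINT = Box 2022 Thm. 1.5 + Thm. 1.4,
provable now from the landed fact `Literature.NumberTheory.Automorphic.Box2022_theorem1_5_modular`).**
For `K` totally real quartic with `√5 ∈ K` and `E / 𝓞 K` (`Δ ≠ 0`) whose `j`-invariant generates
`K` (`2 < (minpoly ℚ j).natDegree`, hence `= 4 = [K : ℚ]`) and which admits framings of
`E[3], E[5], E[7]` with mod-3 image in `B(3)` or `C_s⁺(3) = ⟨diag(1,2), antidiag(1,1)⟩`, mod-5 image
in `B(5)`, mod-7 image in `B(7)` or `G(e7) = ⟨(0 5; 3 0), (5 0; 3 2)⟩` (the crux hypotheses,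
verbatim), `E` is modular (written out as in the crux).  Why plausibly true: `E` gives a quartic
point with quartic `j` on `X₀(105)`, `X(s3,b5,b7)`, `X(b3,b5,e7)` or `X(s3,b5,e7)` (Box §1.1); by
Box 2022 Thm. 1.5 (Thms. 3.1, 4.1, 6.1, Cor. 5.3 — a statement about ALL quartic points, no `√5`
hypothesis) such a point is a `ℚ`-curve or has one of the non-totally-real `j` of Table 1
(impossible, `K` totally real), and `ℚ`-curves are modular (Thm. 1.4: Ribet + Serre's conjecture),
over `K` by solvable base change.  Why it might fail: only if Box's sieve on one of the four curves
silently used `√5 ∉ K` (the route's stated risk; the refuter's audit of Thm. 1.5 says it does not).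
Sources: Box2022 Thms. 1.4, 1.5, 3.1, 4.1, 6.1, Cor. 5.3 (arXiv:2103.13975); Ribet2004QCurves.
Leans on (tree): `Box2022_theorem1_5_modular`, `Box2022_theorem1_5_modular.isHilbertModular`,
`IsHilbertModular.isModularEllipticCurve`. -/
theorem stub_quarticJ :
    ∀ (K : Type) [Field K] [NumberField K], NumberField.IsTotallyReal K → Module.finrank ℚ K = 4 → (∃ r : K, r ^ 2 = 5) → ∀ E : WeierstrassCurve (NumberField.RingOfIntegers K), E.Δ ≠ 0 → 2 < (minpoly ℚ ((E.baseChange K).c₄ ^ 3 / (E.baseChange K).Δ)).natDegree → (∃ ρ : Literature.NumberTheory.GaloisRepresentations.FramedGaloisRep K (ZMod 3) 2, (∃ e : (E.baseChange K).geomTorsion ((3 : ℕ) : ℤ) ≃+ (Fin 2 → ZMod 3), ∀ (σ : Field.absoluteGaloisGroup K) (P : (E.baseChange K).geomTorsion ((3 : ℕ) : ℤ)), e (σ • P) = ((ρ σ : GL (Fin 2) (ZMod 3)) : Matrix (Fin 2) (Fin 2) (ZMod 3)) *ᵥ (e P)) ∧ ((∀ σ : Field.absoluteGaloisGroup K, (((ρ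 σ : GL (Fin 2) (ZMod 3)) : Matrix (Fin 2) (Fin 2) (ZMod 3)) 1 0 = 0)) ∨ (∀ σ : Field.absoluteGaloisGroup K, (ρ σ : GL (Fin 2) (ZMod 3)) ∈ Subgroup.closure ({(⟨!![1, 0; 0, 2], !![1, 0; 0, 2], by decide, by decide⟩ : GL (Fin 2) (ZMod 3)), (⟨!![0, 1; 1, 0], !![0, 1; 1, 0], by decide, by decide⟩ : GL (Fin 2) (ZMod 3))} : Set (GL (Fin 2) (ZMod 3)))))) → (∃ ρ : Literature.NumberTheory.GaloisRepresentations.FramedGaloisRep K (ZMod 5) 2, (∃ e : (E.baseChange K).geomTorsion ((5 : ℕ) : ℤ) ≃+ (Fin 2 → ZMod 5), ∀ (σ : Field.absoluteGaloisGroup K) (P : (E.baseChange K).geomTorsion ((5 : ℕ) : ℤ)), e (σ • P) = ((ρ σ : GL (Fin 2) (ZMod 5)) : Matrix (Fin 2) (Fin 2) (ZMod 5)) *ᵥ (e P)) ∧ (∀ σ : Field.absoluteGaloisGroup K, (((ρ σ : GL (Fin 2) (ZMod 5)) : Matrix (Fin 2) (Fin 2) (ZMod 5)) 1 0 = 0)))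 → (∃ ρ : Literature.NumberTheory.GaloisRepresentations.FramedGaloisRep K (ZMod 7) 2, (∃ e : (E.baseChange K).geomTorsion ((7 : ℕ) : ℤ) ≃+ (Fin 2 → ZMod 7), ∀ (σ : Field.absoluteGaloisGroup K) (P : (E.baseChange K).geomTorsion ((7 : ℕ) : ℤ)), e (σ • P) = ((ρ σ : GL (Fin 2) (ZMod 7)) : Matrix (Fin 2) (Fin 2) (ZMod 7)) *ᵥ (e P)) ∧ ((∀ σ : Field.absoluteGaloisGroup K, (((ρ σ : GL (Fin 2) (ZMod 7)) : Matrix (Fin 2) (Fin 2) (ZMod 7)) 1 0 = 0)) ∨ (∀ σ : Field.absoluteGaloisGroup K, (ρ σ : GL (Fin 2) (ZMod 7)) ∈ Subgroup.closure ({(⟨!![0, 5; 3, 0], !![0, 5; 3, 0], by decide, by decide⟩ : GL (Fin 2) (ZMod 7)), (⟨!![5, 0; 3, 2], !![3, 0; 6, 4], by decide, by decide⟩ : GL (Fin 2) (ZMod 7))} : Set (GL (Fin 2) (ZMod 7)))))) → ((E.baseChange K).HasCM ∨ ∃ (hF : Literature.NumberTheory.Automorphic.isCompact_glFiniteIntegralLevel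 2 K) (π : Literature.NumberTheory.Automorphic.CuspidalAutomorphicRepData 2 K hF), π.1.HasWeightZero ∧ ∀ᶠ w : IsDedekindDomain.HeightOneSpectrum (NumberField.RingOfIntegers K) in Filter.cofinite, ∃ α : Multiset ℂ, π.1.HasSatakeParamAt w α ∧ ((Real.sqrt w.residueCard : ℝ) : ℂ) * α.sum = (Literature.NumberTheory.Automorphic.frobTraceAt E w : ℂ)) := by
  sorry

/-! ## Assembly (sorry-free glue + the registered skeleton theorem) -/

/-- **GLUE (kernel-checked, no `sorry`, axioms ⊆ {propext, Classical.choice, Quot.sound}).**  The two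
stub STATEMENTS, taken as hypotheses, imply the crux statement (conclusion = the body of
`Summit.Langlands.Langlands.Theses.SqrtFiveQuarticCovers.BoxBorelFive` verbatim, so that the A12
skeleton audit sees exactly one theorem concluding the crux BY NAME, `BoxBorelFive_of` below):
split on `2 < (minpoly ℚ j).natDegree` versus `(minpoly ℚ j).natDegree ≤ 2` (`Nat.lt_or_ge`),
`j = c₄³/Δ` of `E_K`; the first branch is `stub_quarticJ`, the second `stub_smallJ` (level structure
and `√5` discarded).  [Box2022 p. 5] -/
theorem BoxBorelFive_of_stubs
    (hS : ∀ (K : Type) [Field K] [NumberField K], NumberField.IsTotallyReal K → Module.finrank ℚ K = 4 → ∀ E : WeierstrassCurve (NumberField.RingOfIntegers K), E.Δ ≠ 0 → (minpoly ℚ ((E.baseChange K).c₄ ^ 3 / (E.baseChange K).Δ)).natDegree ≤ 2 → ((E.baseChange K).HasCM ∨ ∃ (hF : Literature.NumberTheory.Automorphic.isCompact_glFiniteIntegralLevel 2 K) (π : Literature.NumberTheory.Automorphic.CuspidalAutomorphicRepData 2 K hF), π.1.HasWeightZero ∧ ∀ᶠ w : IsDedekindDomain.HeightOneSpectrum (NumberField.RingOfIntegers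 K) in Filter.cofinite, ∃ α : Multiset ℂ, π.1.HasSatakeParamAt w α ∧ ((Real.sqrt w.residueCard : ℝ) : ℂ) * α.sum = (Literature.NumberTheory.Automorphic.frobTraceAt E w : ℂ)))
    (hQ : ∀ (K : Type) [Field K] [NumberField K], NumberField.IsTotallyReal K → Module.finrank ℚ K = 4 → (∃ r : K, r ^ 2 = 5) → ∀ E : WeierstrassCurve (NumberField.RingOfIntegers K), E.Δ ≠ 0 → 2 < (minpoly ℚ ((E.baseChange K).c₄ ^ 3 / (E.baseChange K).Δ)).natDegree → (∃ ρ : Literature.NumberTheory.GaloisRepresentations.FramedGaloisRep K (ZMod 3) 2, (∃ e : (E.baseChange K).geomTorsion ((3 : ℕ) : ℤ) ≃+ (Fin 2 → ZMod 3), ∀ (σ : Field.absoluteGaloisGroup K) (P : (E.baseChange K).geomTorsion ((3 : ℕ) : ℤ)), e (σ • P) = ((ρ σ : GL (Fin 2) (ZMod 3)) : Matrix (Fin 2) (Fin 2) (ZMod 3)) *ᵥ (e P)) ∧ ((∀ σ : Field.absoluteGaloisGroup K, (((ρ σ : GL (Fin 2) (ZMod 3)) : Matrix (Fin 2) (Fin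 2) (ZMod 3)) 1 0 = 0)) ∨ (∀ σ : Field.absoluteGaloisGroup K, (ρ σ : GL (Fin 2) (ZMod 3)) ∈ Subgroup.closure ({(⟨!![1, 0; 0, 2], !![1, 0; 0, 2], by decide, by decide⟩ : GL (Fin 2) (ZMod 3)), (⟨!![0, 1; 1, 0], !![0, 1; 1, 0], by decide, by decide⟩ : GL (Fin 2) (ZMod 3))} : Set (GL (Fin 2) (ZMod 3)))))) → (∃ ρ : Literature.NumberTheory.GaloisRepresentations.FramedGaloisRep K (ZMod 5) 2, (∃ e : (E.baseChange K).geomTorsion ((5 : ℕ) : ℤ) ≃+ (Fin 2 → ZMod 5), ∀ (σ : Field.absoluteGaloisGroup K) (P : (E.baseChange K).geomTorsion ((5 : ℕ) : ℤ)), e (σ • P) = ((ρ σ : GL (Fin 2) (ZMod 5)) : Matrix (Fin 2) (Fin 2) (ZMod 5)) *ᵥ (e P)) ∧ (∀ σ : Field.absoluteGaloisGroup K, (((ρ σ : GL (Fin 2) (ZMod 5)) : Matrix (Fin 2) (Fin 2) (ZMod 5)) 1 0 = 0))) → (∃ ρ : Literature.NumberTheory.GaloisRepresentations.FramedGaloisRep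 K (ZMod 7) 2, (∃ e : (E.baseChange K).geomTorsion ((7 : ℕ) : ℤ) ≃+ (Fin 2 → ZMod 7), ∀ (σ : Field.absoluteGaloisGroup K) (P : (E.baseChange K).geomTorsion ((7 : ℕ) : ℤ)), e (σ • P) = ((ρ σ : GL (Fin 2) (ZMod 7)) : Matrix (Fin 2) (Fin 2) (ZMod 7)) *ᵥ (e P)) ∧ ((∀ σ : Field.absoluteGaloisGroup K, (((ρ σ : GL (Fin 2) (ZMod 7)) : Matrix (Fin 2) (Fin 2) (ZMod 7)) 1 0 = 0)) ∨ (∀ σ : Field.absoluteGaloisGroup K, (ρ σ : GL (Fin 2) (ZMod 7)) ∈ Subgroup.closure ({(⟨!![0, 5; 3, 0], !![0, 5; 3, 0], by decide, by decide⟩ : GL (Fin 2) (ZMod 7)), (⟨!![5, 0; 3, 2], !![3, 0; 6, 4], by decide, by decide⟩ : GL (Fin 2) (ZMod 7))} : Set (GL (Fin 2) (ZMod 7)))))) → ((E.baseChange K).HasCM ∨ ∃ (hF : Literature.NumberTheory.Automorphic.isCompact_glFiniteIntegralLevel 2 K) (π : Literature.NumberTheory.Automorphic.CuspidalAutomorphicRepData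 2 K hF), π.1.HasWeightZero ∧ ∀ᶠ w : IsDedekindDomain.HeightOneSpectrum (NumberField.RingOfIntegers K) in Filter.cofinite, ∃ α : Multiset ℂ, π.1.HasSatakeParamAt w α ∧ ((Real.sqrt w.residueCard : ℝ) : ℂ) * α.sum = (Literature.NumberTheory.Automorphic.frobTraceAt E w : ℂ))) :
    ∀ (K : Type) [Field K] [NumberField K], NumberField.IsTotallyReal K → Module.finrank ℚ K = 4 → (∃ r : K, r ^ 2 = 5) → ∀ E : WeierstrassCurve (NumberField.RingOfIntegers K), E.Δ ≠ 0 → (∃ ρ : Literature.NumberTheory.GaloisRepresentations.FramedGaloisRep K (ZMod 3) 2, (∃ e : (E.baseChange K).geomTorsion ((3 : ℕ) : ℤ) ≃+ (Fin 2 → ZMod 3), ∀ (σ : Field.absoluteGaloisGroup K) (P : (E.baseChange K).geomTorsion ((3 : ℕ) : ℤ)), e (σ • P) = ((ρ σ : GL (Fin 2) (ZMod 3)) : Matrix (Fin 2) (Fin 2) (ZMod 3)) *ᵥ (e P)) ∧ ((∀ σ : Field.absoluteGaloisGroup K, (((ρ σ : GL (Fin 2) (ZMod 3)) : Matrix (Fin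 2) (Fin 2) (ZMod 3)) 1 0 = 0)) ∨ (∀ σ : Field.absoluteGaloisGroup K, (ρ σ : GL (Fin 2) (ZMod 3)) ∈ Subgroup.closure ({(⟨!![1, 0; 0, 2], !![1, 0; 0, 2], by decide, by decide⟩ : GL (Fin 2) (ZMod 3)), (⟨!![0, 1; 1, 0], !![0, 1; 1, 0], by decide, by decide⟩ : GL (Fin 2) (ZMod 3))} : Set (GL (Fin 2) (ZMod 3)))))) → (∃ ρ : Literature.NumberTheory.GaloisRepresentations.FramedGaloisRep K (ZMod 5) 2, (∃ e : (E.baseChange K).geomTorsion ((5 : ℕ) : ℤ) ≃+ (Fin 2 → ZMod 5), ∀ (σ : Field.absoluteGaloisGroup K) (P : (E.baseChange K).geomTorsion ((5 : ℕ) : ℤ)), e (σ • P) = ((ρ σ : GL (Fin 2) (ZMod 5)) : Matrix (Fin 2) (Fin 2) (ZMod 5)) *ᵥ (e P)) ∧ (∀ σ : Field.absoluteGaloisGroup K, (((ρ σ : GL (Fin 2) (ZMod 5)) : Matrix (Fin 2) (Fin 2) (ZMod 5)) 1 0 = 0))) → (∃ ρ : Literature.NumberTheory.GaloisRepresentations.FramedGaloisRep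 K (ZMod 7) 2, (∃ e : (E.baseChange K).geomTorsion ((7 : ℕ) : ℤ) ≃+ (Fin 2 → ZMod 7), ∀ (σ : Field.absoluteGaloisGroup K) (P : (E.baseChange K).geomTorsion ((7 : ℕ) : ℤ)), e (σ • P) = ((ρ σ : GL (Fin 2) (ZMod 7)) : Matrix (Fin 2) (Fin 2) (ZMod 7)) *ᵥ (e P)) ∧ ((∀ σ : Field.absoluteGaloisGroup K, (((ρ σ : GL (Fin 2) (ZMod 7)) : Matrix (Fin 2) (Fin 2) (ZMod 7)) 1 0 = 0)) ∨ (∀ σ : Field.absoluteGaloisGroup K, (ρ σ : GL (Fin 2) (ZMod 7)) ∈ Subgroup.closure ({(⟨!![0, 5; 3, 0], !![0, 5; 3, 0], by decide, by decide⟩ : GL (Fin 2) (ZMod 7)), (⟨!![5, 0; 3, 2], !![3, 0; 6, 4], by decide, by decide⟩ : GL (Fin 2) (ZMod 7))} : Set (GL (Fin 2) (ZMod 7)))))) → ((E.baseChange K).HasCM ∨ ∃ (hF : Literature.NumberTheory.Automorphic.isCompact_glFiniteIntegralLevel 2 K) (π : Literature.NumberTheory.Automorphic.CuspidalAutomorphicRepData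 2 K hF), π.1.HasWeightZero ∧ ∀ᶠ w : IsDedekindDomain.HeightOneSpectrum (NumberField.RingOfIntegers K) in Filter.cofinite, ∃ α : Multiset ℂ, π.1.HasSatakeParamAt w α ∧ ((Real.sqrt w.residueCard : ℝ) : ℂ) * α.sum = (Literature.NumberTheory.Automorphic.frobTraceAt E w : ℂ)) := by
  intro K _ _ hK hd h5 E hE h3 hb5 h7
  rcases Nat.lt_or_ge 2 (minpoly ℚ ((E.baseChange K).c₄ ^ 3 / (E.baseChange K).Δ)).natDegree with hj | hj
  · exact hQ K hK hd h5 E hE hj h3 hb5 h7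
  · exact hS K hK hd E hE hj

/-- **SKELETON THEOREM (registered; concludes the crux BY NAME).**  `BoxBorelFive` from the two
declared stubs through the sorry-free glue `BoxBorelFive_of_stubs`; the only `sorry`s in its closure
are the two `stub_*` bodies. -/
theorem BoxBorelFive_of : Summit.Langlands.Langlands.Theses.SqrtFiveQuarticCovers.BoxBorelFive :=
  BoxBorelFive_of_stubs stub_smallJ stub_quarticJ

end Summit.Langlands.Langlands.Cruxes.BoxBorelFive.Birth
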